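import Literature.Dynamics.Ergodic.BirkhoffErgodicTheoremProofs
import Mathlib.Topology.ContinuousMap.SecondCountableSpace
import Mathlib.Topology.ContinuousMap.Compact
import Mathlib.Topology.Metrizable.Basic
import Mathlib.MeasureTheory.Integral.BoundedContinuousFunction
import Mathlib.Dynamics.BirkhoffSum.Average
import HarnessLib

/-!
# SM2: almost every point of an ergodic measure is generic

Stub `stub_smGenericPoints` of the line `Sketch` (skeleton v10) of the crux
`Summit.NavierStokesRegularity.NavierStokesRegularity.Theses.RecurrentProfiles.RecurrentLiouville`
(stmt-NavierStokesRegularity-1589).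

For a self-map `f` of a compact metrisable space `X` and an ergodic invariant Borel probability
measure `μ`, `μ`-almost every point `x` is *generic*: the Birkhoff averages
`(1/n) ∑_{k<n} g (f^[k] x)` converge to `∫ g dμ` for **every** bounded continuous `g : X →ᵇ ℝ`
simultaneously (Brin–Stuck, *Introduction to Dynamical Systems* (2002), §4.7: "If `T` is ergodic,
then by Corollary 4.5.8, `μ`-a.e. `x` is generic").

Proof.  `X` compact metrisable ⇒ second countable and locally compact, so `C(X, ℝ)` is separable
(`ContinuousMap.instSeparableSpace`), hence so is `X →ᵇ ℝ` (isometric to it,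
`ContinuousMap.isometryEquivBoundedOfCompact`); fix a dense sequence `u : ℕ → (X →ᵇ ℝ)`.  Birkhoff's
pointwise ergodic theorem (tree, PROVED:
`Literature.Dynamics.Ergodic.birkhoff_ergodic_theorem_of_ergodic_holds`) gives for each `k` a full
measure set on which the averages of `u k` converge to `∫ u k dμ`; intersect over `k`.  At a point
of the intersection and for an arbitrary `g`, a `3ε` argument concludes: Birkhoff averages and
`μ`-integrals are both `1`-Lipschitz in the sup norm (`|A_n g (x) - A_n d (x)| ≤ ‖g - d‖`,
`|∫ g - ∫ d| ≤ ‖g - d‖`).  Continuity of `f` is not used (only `Ergodic f μ`); it is part of the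
registered signature.  Mathlib (2026-08) has neither the pointwise ergodic theorem nor generic
points (`birkhoffAverage` occurs only in `Mathlib/Dynamics/BirkhoffSum/*` and
`Mathlib/Analysis/InnerProductSpace/MeanErgodic.lean`; no "generic point" under `Mathlib/Dynamics`,
`Mathlib/MeasureTheory`).

## References

* M. Brin, G. Stuck, *Introduction to Dynamical Systems*, CUP (2002), §4.7 (generic points; "if `T`
  is ergodic then `μ`-a.e. `x` is generic"), Cor. 4.5.8. [BrinStuck2002]
* K. Dajani, C. Kalle, *A First Course in Ergodic Theory*, CRC Press (2021), Thm. 3.1.1 (pointwise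
  ergodic theorem, ergodic case) — the tree's `birkhoff_ergodic_theorem_of_ergodic`.
  [DajaniKalle2021]
-/

noncomputable section

-- the sub-problem namespace repeats the summit name (D-0017 layout `Summit.<S>.<P>.Theorems`)
set_option linter.dupNamespace false

open MeasureTheory Set Function Filter Topology TopologicalSpace
open scoped NNReal ENNReal BoundedContinuousFunction

namespace Summit.NavierStokesRegularity.NavierStokesRegularity.Theorems

/-- Birkhoff averages of a real observable bounded by `C` in absolute value are bounded by `C`:
`|(1/n) ∑_{k<n} φ (f^[k] x)| ≤ C` (for `n = 0` the average is `0 ≤ C`). [folklore] -/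
theorem smGP_abs_birkhoffAverage_le {α : Type*} (f : α → α) {φ : α → ℝ} {C : ℝ} (hC : 0 ≤ C)
    (hφ : ∀ y, |φ y| ≤ C) (n : ℕ) (x : α) : |birkhoffAverage ℝ f φ n x| ≤ C := by
  rcases Nat.eq_zero_or_pos n with rfl | hn
  · simp [birkhoffAverage_zero, hC]
  · have hn' : (0 : ℝ) < n := by exact_mod_cast hn
    simp only [birkhoffAverage, birkhoffSum, smul_eq_mul, abs_mul, abs_inv, Nat.abs_cast]
    calc (n : ℝ)⁻¹ * |∑ k ∈ Finset.range n, φ (f^[k] x)|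
        ≤ (n : ℝ)⁻¹ * ∑ k ∈ Finset.range n, |φ (f^[k] x)| := by
          gcongr
          exact Finset.abs_sum_le_sum_abs _ _
      _ ≤ (n : ℝ)⁻¹ * ∑ _k ∈ Finset.range n, C := by
          gcongr with k _
          exact hφ _
      _ = C := by
          rw [Finset.sum_const, Finset.card_range, nsmul_eq_mul, ← mul_assoc,
            inv_mul_cancel₀ hn'.ne', one_mul]

/-- On a compact metrisable space the bounded continuous real functions `X →ᵇ ℝ` (sup norm) form a
separable space: `X` is second countable and locally compact, so `C(X, ℝ)` is separable
(`ContinuousMap.instSeparableSpace`), and `C(X, ℝ) ≃ᵢ (X →ᵇ ℝ)`. [folklore] -/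
theorem smGP_separableSpace_boundedContinuousFunction (X : Type*) [TopologicalSpace X]
    [CompactSpace X] [MetrizableSpace X] : SeparableSpace (X →ᵇ ℝ) := by
  haveI : SecondCountableTopology X := inferInstance
  haveI : LocallyCompactSpace X := inferInstance
  haveI : SeparableSpace C(X, ℝ) := inferInstance
  exact (ContinuousMap.isometryEquivBoundedOfCompact X ℝ).surjective.denseRange.separableSpace
    (ContinuousMap.isometryEquivBoundedOfCompact X ℝ).continuous

/-- **Almost every point of an ergodic measure is generic** (Brin–Stuck 2002, §4.7), from
ergodicity alone: for an ergodic Borel probability measure `μ` of a self-map `f` of a compact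
metrisable space, for `μ`-a.e. `x` the Birkhoff averages of every `g : X →ᵇ ℝ` along the orbit of
`x` converge to `∫ g dμ`.  (Birkhoff's pointwise ergodic theorem, Dajani–Kalle 2021 Thm. 3.1.1 =
tree `Literature.Dynamics.Ergodic.birkhoff_ergodic_theorem_of_ergodic_holds`, on a dense sequence of
`X →ᵇ ℝ`; countable intersection; `3ε`.) [cite: BrinStuck2002, §4.7] -/
theorem smGP_ae_forall_tendsto_birkhoffAverage {X : Type*} [TopologicalSpace X]
    [MeasurableSpace X] [BorelSpace X] [CompactSpace X] [MetrizableSpace X] {f : X → X}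
    (μ : Measure X) [IsProbabilityMeasure μ] (herg : Ergodic f μ) :
    ∀ᵐ x ∂μ, ∀ g : X →ᵇ ℝ,
      Tendsto (fun n : ℕ => birkhoffAverage ℝ f g n x) atTop (𝓝 (∫ y, g y ∂μ)) := by
  haveI := smGP_separableSpace_boundedContinuousFunction X
  obtain ⟨u, hu⟩ := TopologicalSpace.exists_dense_seq (X →ᵇ ℝ)
  have hB : ∀ k, ∀ᵐ x ∂μ,
      Tendsto (fun n : ℕ => birkhoffAverage ℝ f (u k) n x) atTop (𝓝 (∫ y, u k y ∂μ)) := fun k =>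
    Literature.Dynamics.Ergodic.birkhoff_ergodic_theorem_of_ergodic_holds μ f herg (u k)
      ((u k).integrable μ)
  filter_upwards [ae_all_iff.2 hB] with x hx g
  rw [Metric.tendsto_atTop]
  intro ε hε
  have hε3 : 0 < ε / 3 := by positivity
  obtain ⟨k, hk⟩ := hu.exists_dist_lt g hε3
  obtain ⟨N, hN⟩ := Metric.tendsto_atTop.1 (hx k) (ε / 3) hε3
  refine ⟨N, fun n hn => ?_⟩
  have hgd : ‖g - u k‖ < ε / 3 := by rwa [← dist_eq_norm]
  have h1 : dist (birkhoffAverage ℝ f g n x) (birkhoffAverage ℝ f (u k) n x) ≤ ‖g - u k‖ := by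
    have hsub : birkhoffAverage ℝ f (⇑g - ⇑(u k)) n x
        = birkhoffAverage ℝ f g n x - birkhoffAverage ℝ f (u k) n x := by
      rw [birkhoffAverage_sub]
      rfl
    rw [Real.dist_eq, ← hsub]
    refine smGP_abs_birkhoffAverage_le f (norm_nonneg _) (fun y => ?_) n x
    simpa [Real.norm_eq_abs] using (g - u k).norm_coe_le_norm y
  have h2 : dist (birkhoffAverage ℝ f (u k) n x) (∫ y, u k y ∂μ) < ε / 3 := hN n hn
  have h3 : dist (∫ y, u k y ∂μ) (∫ y, g y ∂μ) ≤ ‖g - u k‖ := by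
    rw [dist_comm, dist_eq_norm, ← integral_sub (g.integrable μ) ((u k).integrable μ)]
    simpa using (g - u k).norm_integral_le_norm μ
  calc dist (birkhoffAverage ℝ f g n x) (∫ y, g y ∂μ)
      ≤ dist (birkhoffAverage ℝ f g n x) (birkhoffAverage ℝ f (u k) n x)
        + dist (birkhoffAverage ℝ f (u k) n x) (∫ y, u k y ∂μ)
        + dist (∫ y, u k y ∂μ) (∫ y, g y ∂μ) := dist_triangle4 _ _ _ _
    _ < ε := by linarith

/-- **SM2, almost every point of an ergodic measure is generic** (Brin–Stuck 2002, §4.7: "if `T`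
is ergodic then `μ`-a.e. `x` is generic"): for a continuous self-map `f` of a compact metrisable
space and an ergodic invariant Borel probability measure `μ`, for `μ`-a.e. `x` the Birkhoff
averages `(1/n) ∑_{k<n} g (f^k x)` converge to `∫ g dμ` for EVERY bounded continuous `g`
simultaneously.  Immediate from `smGP_ae_forall_tendsto_birkhoffAverage` (continuity of `f` is not
needed; the hypothesis is kept because it is part of the registered signature).
[cite: BrinStuck2002, §4.7] -/
theorem stub_smGenericPoints {X : Type*} [TopologicalSpace X] [MeasurableSpace X] [BorelSpace X]
    [CompactSpace X] [MetrizableSpace X] {f : X → X} (hf : Continuous f)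
    (μ : Measure X) [IsProbabilityMeasure μ] (herg : Ergodic f μ) :
    ∀ᵐ x ∂μ, ∀ g : X →ᵇ ℝ,
      Tendsto (fun n : ℕ => birkhoffAverage ℝ f g n x) atTop (𝓝 (∫ y, g y ∂μ)) := by
  -- continuity of `f` is not needed: `Ergodic f μ` already contains the measurability of `f`,
  -- which is all Birkhoff's theorem uses; `hf` is part of the registered signature.
  have _ := hf
  exact smGP_ae_forall_tendsto_birkhoffAverage μ herg

end Summit.NavierStokesRegularity.NavierStokesRegularity.Theorems

end
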